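import Mathlib.Analysis.SpecialFunctions.Pow.Real
import Mathlib.Algebra.BigOperators.Ring.Finset
import Mathlib.Algebra.BigOperators.Intervals
import Mathlib.Algebra.Order.Chebyshev
import HarnessLib

/-!
# Route `UnitScaleTilt`, crux K1 «MinimiserStabilityRegPr» (stmt-QuantumFields-19200), route-R E′, architecture (A′) «HCOW-VIA-Σ» (★★OWNER RULING g28-№13), package P-A4
# «CRUDE SLICE ON PRINT'S SLICE», CURVED — FILE B-β «BUBBLE PROFILE ROWS»: the product parabola `Φ(r) = Π_i β(r_i)`, `β(j) = j·(n − 1 − j)` on the block offsets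
# `r : Fin d → Fin n` (block side `n = ℓ = L^k ≥ 3`), and the five scalar rows the abstract competitor file ✓⧗`Prop7BlockCompetitorEnergy.competitor_energy_le`
# consumes: boundary layer (Φ = 0 when some `r_i ∈ {0, n−1}`), `0 ≤ Φ`, the mass `Σ_r Φ = S₁^d` with `6S₁ = n(n−1)(n−2)`, the square mass `Σ_r Φ² = S₂^d ≤ (n⁵∕16)^d`,
# and the gradient row `Σ_r (Φ(r + e_μ) − Φ(r))² ≤ n³·S₂^{d−1}` per direction (wrap-around successor in `Fin n`; `|β(j+1) − β(j)| ≤ n`)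

Cell `ym3-torus`, width seat `ym3-torus-px19` (gen 5); pens of record px12 g5 2026-08-29 02:39:52Z («B-β = px19»).  WHERE IT SITS: the bubble competitor of LOCATE
`LOCATE-PA4-VARIATIONAL-px19g5.md` §0 (B) ∕ px11 g5 (M2): `fC(x) = Φ(offset x)·σ_x⁻¹ν_{B(x)}`; F1-core's rows (R-∂)(R-A)(R-B) and the Neumann mean `m = w·Σ_rΦ = (S₁∕n)^d` are read off
this file by the member instantiation (offsets of a torus site in its top block ↔ `Fin d → Fin n`, forward bond ↔ `Function.update r μ (r μ + 1)`).  RATIO (lattice units):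
`A∕(m²·n^d) = d·n³·S₂^{d−1}·n^{2d}∕(S₁^{2d}·n^d) ≤ 36^{2d}·d∕16^{d−1}·n^{−2}` — the `ℓ⁻²` of Bernstein.  THEOREMS ONLY (0 `def`, 0 `sorry`); `β`, `Φ` are FREE symbols with defining
hypotheses `hβ`, `hΦ` (consumers instantiate by `fun _ => rfl`).  `--supports stmt-QuantumFields-19200 --as helper`, count-neutral.  YM₃ on T³ is a ladder rung (R3), not the Clay
problem; nothing here claims `bern_P`, `hcoW`, E′, a stub, the crux, d = 4 or the mass gap.

WHAT IS PROVED (ns `…Theorems.Prop7BubbleProfileRows`).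
* §1 the 1-D parabola: `beta_eq_zero_of_val_eq_zero ∕ _of_val_eq_last`, `beta_nonneg`, `beta_le` (`≤ n²∕4`), `abs_beta_add_one_sub_le` (`≤ n`, wrap-around included),
  ★ `six_mul_sum_beta` (`6·Σ_jβ(j) = n(n−1)(n−2)`), `sum_beta_ge` (`n³∕36 ≤ Σβ` for `n ≥ 3`), `sum_beta_sq_le` (`Σβ² ≤ n⁵∕16`).
* §2 the product bubble: `bubble_nonneg`, ★ `bubble_eq_zero_of_boundary`, ★ `sum_bubble_eq` (`Σ_rΦ = (Σβ)^d`), `sum_bubble_sq_eq` (`Σ_rΦ² = (Σβ²)^d`),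
  ★★ `sum_bubble_update_sub_sq_le` (`Σ_r (Φ(update r μ (r μ + 1)) − Φ r)² ≤ n³·(Σβ²)^{d−1}`, any direction `μ`).
HONEST SCOPE.  Finite sums over `Fin n` ∕ `Fin d → Fin n`; no lattice, no analysis.

References: T. Bałaban, CMP 96 (1984) 223–250 [Balaban1984PropagatorsII] (§1: block averages and their minimal interpolants); CMP 99 (1985) 389–434
[Balaban1985BackgroundPropagators] ((3.19)–(3.23) pp.393–394).
-/

set_option autoImplicit false

noncomputable section

open scoped BigOperators
open Finset

namespace Summit.QuantumFields.YangMills.Theorems.Prop7BubbleProfileRows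

/-! ## §1 The 1-D parabola `β(j) = j·(n − 1 − j)` on `Fin n` -/

/-- `6·Σ_{i<m} i(m−1−i) = m(m−1)(m−2)` (Faulhaber degree 2, by induction through `Σ_{i<m+1} i(m−i) = Σ_{i<m} (i(m−1−i) + i)` and Gauss). [folklore] -/
theorem six_mul_sum_range_parabola (m : ℕ) : 6 * ∑ i ∈ range m, (i : ℝ) * ((m : ℝ) - 1 - (i : ℝ)) = (m : ℝ) * ((m : ℝ) - 1) * ((m : ℝ) - 2) := by
  induction m with
  | zero => simp
  | succ m ih =>
    rw [Finset.sum_range_succ]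
    have hsplit : ∑ i ∈ range m, (i : ℝ) * (((m + 1 : ℕ) : ℝ) - 1 - (i : ℝ)) = ∑ i ∈ range m, (i : ℝ) * ((m : ℝ) - 1 - (i : ℝ)) + ∑ i ∈ range m, (i : ℝ) := by
      rw [← Finset.sum_add_distrib]
      refine Finset.sum_congr rfl fun i _ => ?_
      push_cast; ring
    have hgauss : (∑ i ∈ range m, (i : ℝ)) * 2 = (m : ℝ) * ((m : ℝ) - 1) := by
      have h := Finset.sum_range_id_mul_two m
      have h' : ((∑ i ∈ range m, i : ℕ) : ℝ) * 2 = ((m * (m - 1) : ℕ) : ℝ) := by exact_mod_cast h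
      rw [Nat.cast_sum] at h'
      rw [h']
      rcases Nat.eq_zero_or_pos m with hm | hm
      · subst hm; simp
      · rw [Nat.cast_mul, Nat.cast_sub hm, Nat.cast_one]
    rw [hsplit, mul_add, mul_add, ih]
    push_cast
    nlinarith [hgauss]

section OneD

variable {n : ℕ} (β : Fin n → ℝ) (hβ : ∀ j : Fin n, β j = (j : ℝ) * ((n : ℝ) - 1 - (j : ℝ)))
include hβ

/-- `β(0) = 0` (boundary layer, lower face). [folklore] -/
theorem beta_eq_zero_of_val_eq_zero (j : Fin n) (h : (j : ℕ) = 0) : β j = 0 := by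
  rw [hβ j]
  have : (j : ℝ) = 0 := by exact_mod_cast h
  rw [this, zero_mul]

/-- `β(n−1) = 0` (boundary layer, upper face). [folklore] -/
theorem beta_eq_zero_of_val_eq_last (j : Fin n) (h : (j : ℕ) = n - 1) : β j = 0 := by
  rw [hβ j]
  have hn : 1 ≤ n := Nat.succ_le_of_lt (lt_of_le_of_lt (Nat.zero_le _) j.isLt)
  have : (j : ℝ) = (n : ℝ) - 1 := by
    rw [show (j : ℝ) = ((j : ℕ) : ℝ) from rfl, h, Nat.cast_sub hn, Nat.cast_one]
  rw [this, sub_self, mul_zero]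

/-- `0 ≤ β(j)` (`j ≤ n − 1`). [folklore] -/
theorem beta_nonneg (j : Fin n) : 0 ≤ β j := by
  rw [hβ j]
  have h1 : ((j : ℕ) : ℝ) + 1 ≤ (n : ℝ) := by exact_mod_cast Nat.succ_le_of_lt j.isLt
  have h0 : (0 : ℝ) ≤ (j : ℕ) := Nat.cast_nonneg _
  exact mul_nonneg h0 (by linarith)

/-- `β(j) ≤ n²∕4` (AM–GM). [folklore] -/
theorem beta_le (j : Fin n) : β j ≤ (n : ℝ) ^ 2 / 4 := by
  rw [hβ j]
  nlinarith [sq_nonneg (2 * ((j : ℕ) : ℝ) - ((n : ℝ) - 1)), sq_nonneg ((n : ℝ) - 1), Nat.cast_nonneg (α := ℝ) n]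

/-- `|β(j + 1) − β(j)| ≤ n` — the relative Lipschitz constant `≈ 4∕n` of the bubble (wrap-around successor in `Fin n`: at `j = n − 1` both values vanish). [folklore] -/
theorem abs_beta_add_one_sub_le [NeZero n] (j : Fin n) : |β (j + 1) - β j| ≤ n := by
  have hn : 1 ≤ n := Nat.one_le_iff_ne_zero.mpr (NeZero.ne n)
  by_cases hlast : (j : ℕ) = n - 1
  · -- wrap-around: `j + 1 = 0`, both ends of the boundary layer
    have h0 : ((j + 1 : Fin n) : ℕ) = 0 := by
      rw [Fin.val_add, Fin.val_one', hlast]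
      rcases Nat.lt_or_ge 1 n with h | h
      · rw [Nat.mod_eq_of_lt h, Nat.sub_add_cancel hn, Nat.mod_self]
      · have : n = 1 := le_antisymm h hn
        subst this; simp
    rw [beta_eq_zero_of_val_eq_zero β hβ _ h0, beta_eq_zero_of_val_eq_last β hβ _ hlast, sub_zero, abs_zero]
    exact Nat.cast_nonneg _
  · have hlt : (j : ℕ) + 1 < n := by
      have := j.isLt
      omega
    have h1 : ((j + 1 : Fin n) : ℕ) = (j : ℕ) + 1 := by
      rw [Fin.val_add, Fin.val_one', Nat.one_mod_eq_one.mpr (by omega), Nat.mod_eq_of_lt hlt]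
    rw [hβ, hβ, show ((j + 1 : Fin n) : ℝ) = ((j : ℕ) : ℝ) + 1 by rw [show ((j + 1 : Fin n) : ℝ) = (((j + 1 : Fin n) : ℕ) : ℝ) from rfl, h1]; push_cast; ring]
    have hj : ((j : ℕ) : ℝ) + 1 ≤ n := by exact_mod_cast hlt.le
    have hj0 : (0 : ℝ) ≤ (j : ℕ) := Nat.cast_nonneg _
    rw [abs_le]
    constructor <;> nlinarith

/-- ★ **THE MASS, EXACTLY**: `6·Σ_{j<n} j(n−1−j) = n(n−1)(n−2)` (Gauss ∕ Faulhaber degree 2, by induction through `Σ_{j<n+1} j(n−j) = Σ_{j<n} (j(n−1−j) + j)`). [folklore] -/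
theorem six_mul_sum_beta : 6 * ∑ j : Fin n, β j = (n : ℝ) * ((n : ℝ) - 1) * ((n : ℝ) - 2) := by
  have h : ∑ j : Fin n, β j = ∑ i ∈ range n, (i : ℝ) * ((n : ℝ) - 1 - (i : ℝ)) := by
    rw [Finset.sum_range (fun i => (i : ℝ) * ((n : ℝ) - 1 - (i : ℝ)))]
    exact Finset.sum_congr rfl fun j _ => hβ j
  rw [h]
  exact six_mul_sum_range_parabola n

/-- `n³∕36 ≤ Σ_j β(j)` for `n ≥ 3` (the bubble mean `m = (Σβ∕n)^d ≥ (n²∕36)^d` is bounded below — the Neumann row's `μ = 2∕m`). [folklore] -/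
theorem sum_beta_ge (hn : 3 ≤ n) : (n : ℝ) ^ 3 / 36 ≤ ∑ j : Fin n, β j := by
  have h := six_mul_sum_beta β hβ
  have h3 : (3 : ℝ) ≤ n := by exact_mod_cast hn
  have hprod : 0 ≤ (n : ℝ) * ((n : ℝ) - 3) * (5 * (n : ℝ) - 3) :=
    mul_nonneg (mul_nonneg (by linarith) (by linarith)) (by linarith)
  have e : 6 * ((n : ℝ) * ((n : ℝ) - 1) * ((n : ℝ) - 2)) = (n : ℝ) ^ 3 + ((n : ℝ) * ((n : ℝ) - 3) * (5 * (n : ℝ) - 3) + 3 * (n : ℝ)) := by ring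
  nlinarith [h, e, hprod, h3]

/-- `Σ_j β(j)² ≤ n⁵∕16` (`β ≤ n²∕4`, `n` terms). [folklore] -/
theorem sum_beta_sq_le : ∑ j : Fin n, β j ^ 2 ≤ (n : ℝ) ^ 5 / 16 := by
  calc ∑ j : Fin n, β j ^ 2 ≤ ∑ _j : Fin n, ((n : ℝ) ^ 2 / 4) ^ 2 :=
        Finset.sum_le_sum fun j _ => pow_le_pow_left₀ (beta_nonneg β hβ j) (beta_le β hβ j) 2
    _ = (n : ℝ) ^ 5 / 16 := by rw [Finset.sum_const, Finset.card_univ, Fintype.card_fin, nsmul_eq_mul]; ring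

end OneD

/-! ## §2 The product bubble `Φ(r) = Π_i β(r_i)` on the block offsets `r : Fin d → Fin n` -/

section Product

variable {d n : ℕ} (β : Fin n → ℝ) (hβ : ∀ j : Fin n, β j = (j : ℝ) * ((n : ℝ) - 1 - (j : ℝ)))
  (Φ : (Fin d → Fin n) → ℝ) (hΦ : ∀ r, Φ r = ∏ i, β (r i))
include hβ hΦ

/-- `0 ≤ Φ(r)`. [folklore] -/
theorem bubble_nonneg (r : Fin d → Fin n) : 0 ≤ Φ r := by
  rw [hΦ r]; exact Finset.prod_nonneg fun i _ => beta_nonneg β hβ (r i)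

/-- ★ **BOUNDARY LAYER**: `Φ(r) = 0` as soon as one offset coordinate is `0` or `n − 1` — so on every inter-block bond both bubble values vanish (row (R-∂) of
`competitor_energy_le`). [cite: Balaban1984PropagatorsII, (2.7)-(2.12) pp.224-225] -/
theorem bubble_eq_zero_of_boundary (r : Fin d → Fin n) (i : Fin d) (h : (r i : ℕ) = 0 ∨ (r i : ℕ) = n - 1) : Φ r = 0 := by
  rw [hΦ r]
  refine Finset.prod_eq_zero (Finset.mem_univ i) ?_
  rcases h with h | h
  · exact beta_eq_zero_of_val_eq_zero β hβ _ h
  · exact beta_eq_zero_of_val_eq_last β hβ _ h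

omit hβ in
/-- ★ **THE MASS**: `Σ_r Φ(r) = (Σ_j β(j))^d`. [folklore] -/
theorem sum_bubble_eq : ∑ r : Fin d → Fin n, Φ r = (∑ j : Fin n, β j) ^ d := by
  rw [Finset.sum_congr rfl fun r _ => hΦ r, ← Fintype.prod_sum (fun (_ : Fin d) (j : Fin n) => β j), Finset.prod_const, Finset.card_univ,
    Fintype.card_fin]

omit hβ in
/-- **THE SQUARE MASS**: `Σ_r Φ(r)² = (Σ_j β(j)²)^d` (row (R-B) up to the direction count). [folklore] -/
theorem sum_bubble_sq_eq : ∑ r : Fin d → Fin n, Φ r ^ 2 = (∑ j : Fin n, β j ^ 2) ^ d := by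
  have h : ∀ r : Fin d → Fin n, Φ r ^ 2 = ∏ i, β (r i) ^ 2 := fun r => by rw [hΦ r, Finset.prod_pow]
  rw [Finset.sum_congr rfl fun r _ => h r, ← Fintype.prod_sum (fun (_ : Fin d) (j : Fin n) => β j ^ 2), Finset.prod_const, Finset.card_univ,
    Fintype.card_fin]

/-- ★★ **THE GRADIENT ROW**: in each direction `μ`, `Σ_r (Φ(update r μ (r μ + 1)) − Φ(r))² ≤ n³·(Σ_j β(j)²)^{d−1}` (the factor `(β(r_μ+1) − β(r_μ))² ≤ n²` times the product of
the other coordinates' `β²`, summed: `n` free values of `r_μ` times `S₂^{d−1}`) — row (R-A) of `competitor_energy_le` (wrap-around successor; at `r_μ = n−1` both bubbles vanish).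
[cite: Balaban1984PropagatorsII, (2.7)-(2.12) pp.224-225] -/
theorem sum_bubble_update_sub_sq_le [NeZero n] (μ : Fin d) :
    ∑ r : Fin d → Fin n, (Φ (Function.update r μ (r μ + 1)) - Φ r) ^ 2 ≤ (n : ℝ) ^ 3 * (∑ j : Fin n, β j ^ 2) ^ (d - 1) := by
  classical
  -- pointwise: `(Φ(r⁺) − Φ(r))² ≤ n²·Π_{i≠μ} β(r i)²`
  have hpt : ∀ r : Fin d → Fin n, (Φ (Function.update r μ (r μ + 1)) - Φ r) ^ 2 ≤ (n : ℝ) ^ 2 * ∏ i ∈ univ.erase μ, β (r i) ^ 2 := by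
    intro r
    have e1 : Φ (Function.update r μ (r μ + 1)) = β (r μ + 1) * ∏ i ∈ univ.erase μ, β (r i) := by
      rw [hΦ, ← Finset.mul_prod_erase univ _ (Finset.mem_univ μ), Function.update_self]
      congr 1
      exact Finset.prod_congr rfl fun i hi => by rw [Function.update_of_ne (Finset.ne_of_mem_erase hi)]
    have e2 : Φ r = β (r μ) * ∏ i ∈ univ.erase μ, β (r i) := by
      rw [hΦ, ← Finset.mul_prod_erase univ _ (Finset.mem_univ μ)]
    rw [e1, e2, ← sub_mul, mul_pow, ← Finset.prod_pow]
    refine mul_le_mul_of_nonneg_right ?_ (Finset.prod_nonneg fun i _ => sq_nonneg _)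
    have hab := abs_beta_add_one_sub_le β hβ (r μ)
    have h0 : 0 ≤ |β (r μ + 1) - β (r μ)| := abs_nonneg _
    calc (β (r μ + 1) - β (r μ)) ^ 2 = |β (r μ + 1) - β (r μ)| ^ 2 := (sq_abs _).symm
      _ ≤ (n : ℝ) ^ 2 := pow_le_pow_left₀ h0 hab 2
  refine (Finset.sum_le_sum fun r _ => hpt r).trans ?_
  rw [← Finset.mul_sum]
  -- `Σ_r Π_{i≠μ} β(r i)² = n·S₂^{d−1}`
  have hsum : ∑ r : Fin d → Fin n, ∏ i ∈ univ.erase μ, β (r i) ^ 2 = (n : ℝ) * (∑ j : Fin n, β j ^ 2) ^ (d - 1) := by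
    have e : ∀ r : Fin d → Fin n, ∏ i ∈ univ.erase μ, β (r i) ^ 2 = ∏ i, (if i = μ then (1 : ℝ) else β (r i) ^ 2) := by
      intro r
      rw [← Finset.mul_prod_erase univ _ (Finset.mem_univ μ), if_pos rfl, one_mul]
      exact Finset.prod_congr rfl fun i hi => by rw [if_neg (Finset.ne_of_mem_erase hi)]
    rw [Finset.sum_congr rfl fun r _ => e r, ← Fintype.prod_sum (fun (i : Fin d) (j : Fin n) => if i = μ then (1 : ℝ) else β j ^ 2)]
    rw [← Finset.mul_prod_erase univ _ (Finset.mem_univ μ)]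
    have hμ : ∑ _j : Fin n, (if μ = μ then (1 : ℝ) else β _j ^ 2) = n := by simp
    have hi : ∀ i ∈ univ.erase μ, ∑ j : Fin n, (if i = μ then (1 : ℝ) else β j ^ 2) = ∑ j : Fin n, β j ^ 2 := by
      intro i hi
      exact Finset.sum_congr rfl fun j _ => if_neg (Finset.ne_of_mem_erase hi)
    rw [hμ, Finset.prod_congr rfl hi, Finset.prod_const, Finset.card_erase_of_mem (Finset.mem_univ μ), Finset.card_univ, Fintype.card_fin]
  rw [hsum]
  have hS : 0 ≤ (∑ j : Fin n, β j ^ 2) ^ (d - 1) := pow_nonneg (Finset.sum_nonneg fun _ _ => sq_nonneg _) _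
  have hn0 : (0 : ℝ) ≤ n := Nat.cast_nonneg _
  nlinarith [mul_nonneg (mul_nonneg hn0 hn0) (mul_nonneg hn0 hS)]

end Product

end Summit.QuantumFields.YangMills.Theorems.Prop7BubbleProfileRows

end
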